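import Mathlib

/-!
# K-C3 §H2L piece K2b (W4.4b): the normalisation of the E₆ curve `z³ + t⁴`

[OURS · L1 w44b] Towards `conductorIdeal_cusp34` (res-type-011 11:41:54Z signature): the normalisation map
`k⟦z,t⟧ → k⟦s⟧`, `z ↦ -s⁴`, `t ↦ s³`, kills `z³ + t⁴`.  First brick only (the hom and its values); the kernel
computation (Weierstrass division) and the conductor identity follow in later bricks.
NOT a statement of the manuscript under review.
-/

set_option linter.dupNamespace false

noncomputable section

open MvPowerSeries

namespace Summit.ResolutionOfSingularities.ResolutionOfSingularities.Theorems.HomologicalConductor.Cusp34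

universe u

variable (k : Type u) [Field k]

/-- The target series of the normalisation substitution: `z ↦ -s⁴`, `t ↦ s³`. [OURS] -/
def normImg : Fin 2 → PowerSeries k := ![-(PowerSeries.X : PowerSeries k) ^ 4, (PowerSeries.X : PowerSeries k) ^ 3]

/-- The substitution `z ↦ -s⁴, t ↦ s³` is admissible (constant coefficients vanish). [OURS] -/
theorem hasSubst_normImg : MvPowerSeries.HasSubst (normImg k) := by
  refine MvPowerSeries.hasSubst_of_constantCoeff_zero ?_
  intro i
  fin_cases i <;> simp [normImg, PowerSeries.X, MvPowerSeries.constantCoeff_X]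

/-- The normalisation homomorphism `ν : k⟦z,t⟧ →ₐ[k] k⟦s⟧`, `z ↦ -s⁴`, `t ↦ s³`. [OURS] -/
def normHom : MvPowerSeries (Fin 2) k →ₐ[k] PowerSeries k :=
  MvPowerSeries.substAlgHom (hasSubst_normImg k)

/-- `ν(z) = -s⁴`. [OURS] -/
theorem normHom_X_zero : normHom k (X 0) = -(PowerSeries.X : PowerSeries k) ^ 4 := by
  unfold normHom
  rw [MvPowerSeries.substAlgHom_X]
  simp [normImg]

/-- `ν(t) = s³`. [OURS] -/
theorem normHom_X_one : normHom k (X 1) = (PowerSeries.X : PowerSeries k) ^ 3 := by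
  unfold normHom
  rw [MvPowerSeries.substAlgHom_X]
  simp [normImg]

/-- `ν(z³ + t⁴) = 0`: the substitution factors through the E₆ curve `k⟦z,t⟧/(z³ + t⁴)`. [OURS] -/
theorem normHom_cusp34 : normHom k (X 0 ^ 3 + X 1 ^ 4) = 0 := by
  rw [map_add, map_pow, map_pow, normHom_X_zero, normHom_X_one]
  ring

/-- The induced map `ν̄ : k⟦z,t⟧/(z³ + t⁴) →+* k⟦s⟧`. [OURS] -/
def normQuotHom : (MvPowerSeries (Fin 2) k ⧸ Ideal.span {(X 0 ^ 3 + X 1 ^ 4 : MvPowerSeries (Fin 2) k)}) →+* PowerSeries k :=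
  Ideal.Quotient.lift _ (normHom k).toRingHom (by
    intro a ha
    rw [Ideal.mem_span_singleton] at ha
    obtain ⟨b, rfl⟩ := ha
    simp [normHom_cusp34])

/-- `ν̄(z̄) = -s⁴`. [OURS] -/
theorem normQuotHom_mk_X_zero :
    normQuotHom k (Ideal.Quotient.mk _ (X 0)) = -(PowerSeries.X : PowerSeries k) ^ 4 := by
  simp [normQuotHom, normHom_X_zero]

/-- `ν̄(t̄) = s³`. [OURS] -/
theorem normQuotHom_mk_X_one :
    normQuotHom k (Ideal.Quotient.mk _ (X 1)) = (PowerSeries.X : PowerSeries k) ^ 3 := by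
  simp [normQuotHom, normHom_X_one]

end Summit.ResolutionOfSingularities.ResolutionOfSingularities.Theorems.HomologicalConductor.Cusp34

end
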